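import Mathlib.CategoryTheory.Limits.Preserves.Finite
import Mathlib.CategoryTheory.Limits.Preserves.Shapes.Terminal
import Mathlib.CategoryTheory.Limits.Shapes.Equalizers
import Mathlib.CategoryTheory.Adjunction.Mates
import Literature.AnabelianGeometry.Anabelioids.SlimFiniteEtale
import Literature.AnabelianGeometry.Anabelioids.SlimFiniteEtaleProofs

/-!
# [GeoAn] Proposition 1.2.5 (ii) — proofs: full faithfulness of `S ↦ (X_S → X)` (existence in general; uniqueness for slim `X`)

Mochizuki, *The geometry of anabelioids*, Publ. RIMS **40** (2004), Prop. 1.2.5 (ii), ms. p. 19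
[cite: MochizukiGeoAn2004, Prop. 1.2.5(ii) p.19]: for a slim connected anabelioid `X`, the functor
`F_X : X → Ét(X)`, `S ↦ (X_S → X)`, is fully faithful. The tree's rendering (`proposition_1_2_5_ii`,
`Anabelioids/SlimFiniteEtale.lean`, abc-iut-L3-t1): every exact `Q : X_T ⥤ X_S` that is finite étale and
1-commutes with the structure morphisms (`i_T^* ⋙ Q ≅ i_S^*`, `i^* = Over.star`) is `≅ f^* = Over.pullback f`
for a UNIQUE `f : S ⟶ T`. This proof-only companion (abc-iut cell, ROW abc-iut-L6-d6 GeoAn:Prop1.2.5(ii),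
L3-lead 2026-08-25T20:39:37Z) proves the EXISTENCE of `f` ("fullness") and isolates what it needs:

* `Prop125ii.exists_iso_pullback`: in ANY category with binary products and pullbacks, for ANY functor
  `Q : Over T ⥤ Over S` preserving finite limits and ANY `e : Over.star T ⋙ Q ≅ Over.star S`, the morphism
  `f : S ⟶ T` obtained by reading `Q(Δ_T)` through `e` satisfies `Q ≅ Over.pullback f`. Neither slimness,
  nor the Galois structure, nor finite étaleness of `Q`, nor colimit preservation is used: every `b : B → T`
  is the equalizer in `X_T` of `i_T^*(b)` and the "diagonal of the structure map" `i_T^*(B) → (T = T) → i_T^*(T)`;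
  `Q` preserves that equalizer; `e` identifies the parallel pair with `i_S^*(b)` against
  `i_S^*(B) → (S = S) →(1,f) i_S^*(T)`, whose equalizer is `B ×_T S = f^*(B)`. All morphisms into objects
  `i^*(A)` are handled through the adjunction `Over.forget ⊣ Over.star` (transposes), never through the
  internal description of `Over.star`.
* `proposition_1_2_5_ii_exists`: the existence clause of `proposition_1_2_5_ii`, for every Galois category
  (slim or not).
* UNIQUENESS of `f` ("faithfulness") genuinely needs slimness (in `B(Π)`: two maps `Π/U → Π/V` give
  isomorphic restriction functors iff they differ by an element centralising `U`). APPENDED (second filing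
  round): `Prop125ii.eq_of_iso_pullback` — for SLIM `X`, `Over.pullback f ≅ Over.pullback g ⇒ f = g`, by mates
  (`Over.map f ⊣ Over.pullback f`: the isomorphism transposes to `Over.map g ≅ Over.map f`), whose image
  under `Over.forget T` is an automorphism of the extension functor `Over.forget S`, trivial by
  abc-iut-L3-d6's `forget_rigid` ([GeoAn] Prop. 1.2.5 (i), `SlimFiniteEtaleProofs.lean`); reading the
  component at `(S = S)` gives `𝟙 ≫ f = 𝟙 ≫ g`. Hence **`proposition_1_2_5_ii_holds : proposition_1_2_5_ii`**
  — the named fact AS TYPED. [cite: MochizukiGeoAn2004, Prop. 1.2.5(ii) p.19]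
-/

noncomputable section

namespace Literature.AnabelianGeometry.Anabelioids

open CategoryTheory CategoryTheory.Limits

universe v u

namespace Prop125ii

variable {C : Type u} [Category.{v} C] [HasBinaryProducts C]

/-! ### Transposes along `Over.forget T ⊣ Over.star T` -/

/-- The transpose `B.left ⟶ A` of a morphism `B ⟶ i_T^*(A)` (adjunction `Over.forget T ⊣ Over.star T`).
[cite: MochizukiGeoAn2004, Prop. 1.2.5(ii) p.19] -/
abbrev tr {T : C} {B : Over T} {A : C} (g : B ⟶ (Over.star T).obj A) : B.left ⟶ A :=
  ((Over.forgetAdjStar T).homEquiv B A).symm g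

/-- The morphism `B ⟶ i_T^*(A)` with prescribed transpose `B.left ⟶ A`. [cite: MochizukiGeoAn2004, Prop. 1.2.5(ii) p.19] -/
abbrev ofTr {T : C} (B : Over T) {A : C} (g : B.left ⟶ A) : B ⟶ (Over.star T).obj A :=
  (Over.forgetAdjStar T).homEquiv B A g

/-- Bookkeeping step of the proof (`tr_injective`). [cite: MochizukiGeoAn2004, Prop. 1.2.5(ii) p.19] -/
theorem tr_injective {T : C} {B : Over T} {A : C} :
    Function.Injective (tr : (B ⟶ (Over.star T).obj A) → (B.left ⟶ A)) :=
  ((Over.forgetAdjStar T).homEquiv B A).symm.injective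

/-- Bookkeeping step of the proof (`tr_ofTr`). [cite: MochizukiGeoAn2004, Prop. 1.2.5(ii) p.19] -/
@[simp] theorem tr_ofTr {T : C} (B : Over T) {A : C} (g : B.left ⟶ A) : tr (ofTr B g) = g :=
  ((Over.forgetAdjStar T).homEquiv B A).symm_apply_apply g

/-- Bookkeeping step of the proof (`tr_comp_left`). [cite: MochizukiGeoAn2004, Prop. 1.2.5(ii) p.19] -/
theorem tr_comp_left {T : C} {B B' : Over T} {A : C} (k : B ⟶ B') (g : B' ⟶ (Over.star T).obj A) :
    tr (k ≫ g) = k.left ≫ tr g :=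
  (Over.forgetAdjStar T).homEquiv_naturality_left_symm k g

/-- Bookkeeping step of the proof (`tr_comp_map`). [cite: MochizukiGeoAn2004, Prop. 1.2.5(ii) p.19] -/
theorem tr_comp_map {T : C} {B : Over T} {A A' : C} (g : B ⟶ (Over.star T).obj A) (a : A ⟶ A') :
    tr (g ≫ (Over.star T).map a) = tr g ≫ a :=
  (Over.forgetAdjStar T).homEquiv_naturality_right_symm g a

/-- The transpose of a morphism into the terminal object `(T = T)` followed by any `h` is the structure
map followed by the transpose of `h`. [cite: MochizukiGeoAn2004, Prop. 1.2.5(ii) p.19] -/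
theorem tr_toId_comp {T : C} {B : Over T} {A : C} (k : B ⟶ Over.mk (𝟙 T)) (h : Over.mk (𝟙 T) ⟶ (Over.star T).obj A) :
    tr (k ≫ h) = B.hom ≫ tr h := by
  rw [tr_comp_left]
  congr 1
  have hk := Over.w k
  erw [Category.comp_id] at hk
  exact hk

/-! ### Every object `b : B → T` of `Over T` is an equalizer of objects in the image of `i_T^*` -/

/-- The graph `B ⟶ i_T^*(B)`: transpose `𝟙_B` (the unit of the adjunction). [cite: MochizukiGeoAn2004, Prop. 1.2.5(ii) p.19] -/
abbrev graphHom {T : C} (B : Over T) : B ⟶ (Over.star T).obj B.left := ofTr B (𝟙 B.left)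

/-- The section `(T = T) ⟶ i_T^*(A)` with transpose `a : T ⟶ A`; for `a = 𝟙 T` the diagonal `Δ_T`.
[cite: MochizukiGeoAn2004, Prop. 1.2.5(ii) p.19] -/
abbrev sec (T : C) {A : C} (a : T ⟶ A) : Over.mk (𝟙 T) ⟶ (Over.star T).obj A := ofTr (Over.mk (𝟙 T)) a

/-- Bookkeeping step of the proof (`tr_graphHom`). [cite: MochizukiGeoAn2004, Prop. 1.2.5(ii) p.19] -/
@[simp] theorem tr_graphHom {T : C} (B : Over T) : tr (graphHom B) = 𝟙 B.left := tr_ofTr _ _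

/-- Bookkeeping step of the proof (`tr_sec`). [cite: MochizukiGeoAn2004, Prop. 1.2.5(ii) p.19] -/
@[simp] theorem tr_sec (T : C) {A : C} (a : T ⟶ A) : tr (sec T a) = a := tr_ofTr _ _

/-- First arrow of the parallel pair: `i_T^*(b)`. [cite: MochizukiGeoAn2004, Prop. 1.2.5(ii) p.19] -/
abbrev leftArrow {T : C} (B : Over T) : (Over.star T).obj B.left ⟶ (Over.star T).obj T :=
  (Over.star T).map B.hom

/-- Second arrow of the parallel pair (with parameter `a : T ⟶ A`): `i_T^*(B) → (T = T) →(sec a) i_T^*(A)`;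
`a = 𝟙 T` on the `T` side, `a = f` on the `S` side. [cite: MochizukiGeoAn2004, Prop. 1.2.5(ii) p.19] -/
def rightArrow (T B₀ : C) {A : C} (a : T ⟶ A) : (Over.star T).obj B₀ ⟶ (Over.star T).obj A :=
  Over.mkIdTerminal.from ((Over.star T).obj B₀) ≫ sec T a

/-- Bookkeeping step of the proof (`tr_comp_rightArrow`). [cite: MochizukiGeoAn2004, Prop. 1.2.5(ii) p.19] -/
theorem tr_comp_rightArrow {T : C} {W : Over T} {B₀ A : C} (g : W ⟶ (Over.star T).obj B₀) (a : T ⟶ A) :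
    tr (g ≫ rightArrow T B₀ a) = W.hom ≫ a := by
  rw [rightArrow, ← Category.assoc, tr_toId_comp, tr_sec]

/-- Bookkeeping step of the proof (`graphHom_condition`). [cite: MochizukiGeoAn2004, Prop. 1.2.5(ii) p.19] -/
theorem graphHom_condition {T : C} (B : Over T) :
    graphHom B ≫ leftArrow B = graphHom B ≫ rightArrow T B.left (𝟙 T) := by
  apply tr_injective
  rw [tr_comp_map, tr_comp_rightArrow, tr_graphHom, Category.id_comp, Category.comp_id]

/-- The fork `B ⟶ i_T^*(B) ⇉ i_T^*(T)` in `Over T`. [cite: MochizukiGeoAn2004, Prop. 1.2.5(ii) p.19] -/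
def forkT {T : C} (B : Over T) : Fork (leftArrow B) (rightArrow T B.left (𝟙 T)) :=
  Fork.ofι (graphHom B) (graphHom_condition B)

/-- **Every object of `Over T` is the equalizer of `i_T^*(b)` and the diagonal-of-the-structure-map arrow.**
[cite: MochizukiGeoAn2004, Prop. 1.2.5(ii) p.19] -/
def isLimitForkT {T : C} (B : Over T) : IsLimit (forkT B) :=
  Fork.IsLimit.mk _
    (fun s => Over.homMk (tr s.ι) (by
      have h := congrArg tr s.condition
      rw [tr_comp_map, tr_comp_rightArrow, Category.comp_id] at h
      exact h))
    (fun s => by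
      apply tr_injective
      erw [tr_comp_left]
      change tr s.ι ≫ tr (graphHom B) = tr s.ι
      rw [tr_graphHom, Category.comp_id])
    (fun s m hm => by
      ext1
      have h : tr (m ≫ graphHom B) = tr s.ι := congrArg tr hm
      erw [tr_comp_left, tr_graphHom, Category.comp_id] at h
      exact h)

/-- Bookkeeping step of the proof (`graphHom_naturality`). [cite: MochizukiGeoAn2004, Prop. 1.2.5(ii) p.19] -/
theorem graphHom_naturality {T : C} {B B' : Over T} (k : B ⟶ B') :
    k ≫ graphHom B' = graphHom B ≫ (Over.star T).map k.left := by
  apply tr_injective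
  rw [tr_comp_left, tr_graphHom, tr_comp_map, tr_graphHom, Category.comp_id, Category.id_comp]

/-! ### The base change `f^*(B) = B ×_T S` as the corresponding equalizer in `Over S` -/

section Pullback

variable [HasPullbacks C]

/-- `f^*(B) ⟶ i_S^*(B)`: transpose = the projection `B ×_T S ⟶ B`. [cite: MochizukiGeoAn2004, Prop. 1.2.5(ii) p.19] -/
abbrev iotaP {S T : C} (f : S ⟶ T) (B : Over T) : (Over.pullback f).obj B ⟶ (Over.star S).obj B.left :=
  ofTr ((Over.pullback f).obj B) (pullback.fst B.hom f)

/-- Bookkeeping step of the proof (`tr_iotaP`). [cite: MochizukiGeoAn2004, Prop. 1.2.5(ii) p.19] -/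
@[simp] theorem tr_iotaP {S T : C} (f : S ⟶ T) (B : Over T) : tr (iotaP f B) = pullback.fst B.hom f :=
  tr_ofTr _ _

omit [HasBinaryProducts C] in
/-- Bookkeeping step of the proof (`pullback_obj_hom'`). [cite: MochizukiGeoAn2004, Prop. 1.2.5(ii) p.19] -/
theorem pullback_obj_hom' {S T : C} (f : S ⟶ T) (B : Over T) :
    ((Over.pullback f).obj B).hom = pullback.snd B.hom f := Over.pullback_obj_hom f B

/-- Bookkeeping step of the proof (`iotaP_condition`). [cite: MochizukiGeoAn2004, Prop. 1.2.5(ii) p.19] -/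
theorem iotaP_condition {S T : C} (f : S ⟶ T) (B : Over T) :
    iotaP f B ≫ (Over.star S).map B.hom = iotaP f B ≫ rightArrow S B.left f := by
  apply tr_injective
  rw [tr_comp_map, tr_comp_rightArrow, tr_iotaP, pullback_obj_hom']
  exact pullback.condition

/-- The fork `f^*(B) ⟶ i_S^*(B) ⇉ i_S^*(T)` in `Over S`. [cite: MochizukiGeoAn2004, Prop. 1.2.5(ii) p.19] -/
def forkS {S T : C} (f : S ⟶ T) (B : Over T) : Fork ((Over.star S).map B.hom) (rightArrow S B.left f) :=
  Fork.ofι (iotaP f B) (iotaP_condition f B)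

/-- **`f^*(B) = B ×_T S` is the equalizer of `i_S^*(b)` and `i_S^*(B) → (S = S) →(1,f) i_S^*(T)`.**
[cite: MochizukiGeoAn2004, Prop. 1.2.5(ii) p.19] -/
def isLimitForkS {S T : C} (f : S ⟶ T) (B : Over T) : IsLimit (forkS f B) :=
  Fork.IsLimit.mk _
    (fun s => Over.homMk (pullback.lift (tr s.ι) s.pt.hom (by
        have h := congrArg tr s.condition
        rw [tr_comp_map, tr_comp_rightArrow] at h
        exact h))
      (by
        change pullback.lift _ _ _ ≫ ((Over.pullback f).obj B).hom = _
        rw [pullback_obj_hom', pullback.lift_snd]))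
    (fun s => by
      apply tr_injective
      erw [tr_comp_left]
      change pullback.lift (tr s.ι) s.pt.hom _ ≫ tr (iotaP f B) = tr s.ι
      rw [tr_iotaP, pullback.lift_fst])
    (fun s m hm => by
      ext1
      have h1 : tr (m ≫ iotaP f B) = tr s.ι := congrArg tr hm
      erw [tr_comp_left, tr_iotaP] at h1
      have h2 : m.left ≫ pullback.snd B.hom f = s.pt.hom := by
        rw [← pullback_obj_hom' f B]; exact Over.w m
      change m.left = pullback.lift (tr s.ι) s.pt.hom _
      apply pullback.hom_ext
      · erw [pullback.lift_fst]; exact h1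
      · erw [pullback.lift_snd]; exact h2)

/-- Bookkeeping step of the proof (`mono_iotaP`). [cite: MochizukiGeoAn2004, Prop. 1.2.5(ii) p.19] -/
instance mono_iotaP {S T : C} (f : S ⟶ T) (B : Over T) : Mono (iotaP f B) :=
  mono_of_isLimit_fork (isLimitForkS f B)

/-- Bookkeeping step of the proof (`iotaP_naturality`). [cite: MochizukiGeoAn2004, Prop. 1.2.5(ii) p.19] -/
theorem iotaP_naturality {S T : C} (f : S ⟶ T) {B B' : Over T} (k : B ⟶ B') :
    (Over.pullback f).map k ≫ iotaP f B' = iotaP f B ≫ (Over.star S).map k.left := by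
  apply tr_injective
  rw [tr_comp_left, tr_iotaP, tr_comp_map, tr_iotaP]
  simp only [Over.pullback_map_left]
  exact pullback.lift_fst _ _ _

/-! ### The construction of `f` from `Q` and `e : i_T^* ⋙ Q ≅ i_S^*` -/

variable {S T : C} (Q : Over T ⥤ Over S) [PreservesFiniteLimits Q] (e : Over.star T ⋙ Q ≅ Over.star S)

/-- `Q` carries the terminal object `(T = T)` to a terminal object of `Over S`. [cite: MochizukiGeoAn2004, Prop. 1.2.5(ii) p.19] -/
def isTerminalQId : IsTerminal (Q.obj (Over.mk (𝟙 T))) :=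
  Over.mkIdTerminal.isTerminalObj Q (Over.mk (𝟙 T))

/-- The comparison `(S = S) ≅ Q(T = T)` of terminal objects of `Over S`. [cite: MochizukiGeoAn2004, Prop. 1.2.5(ii) p.19] -/
def idIso : Over.mk (𝟙 S) ≅ Q.obj (Over.mk (𝟙 T)) :=
  Over.mkIdTerminal.uniqueUpToIso (isTerminalQId Q)

/-- `γ := Q(Δ_T)` read through `e`: a section `(S = S) ⟶ i_S^*(T)`. [cite: MochizukiGeoAn2004, Prop. 1.2.5(ii) p.19] -/
def gamma : Over.mk (𝟙 S) ⟶ (Over.star S).obj T :=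
  (idIso Q).hom ≫ Q.map (sec T (𝟙 T)) ≫ e.hom.app T

/-- **The morphism `f : S ⟶ T` attached to `Q`**: the transpose of `γ`. [cite: MochizukiGeoAn2004, Prop. 1.2.5(ii) p.19] -/
def theHom : S ⟶ T := tr (gamma Q e)

omit [HasPullbacks C] in
/-- Bookkeeping step of the proof (`sec_theHom`). [cite: MochizukiGeoAn2004, Prop. 1.2.5(ii) p.19] -/
theorem sec_theHom : sec S (theHom Q e) = gamma Q e :=
  ((Over.forgetAdjStar S).homEquiv _ _).apply_symm_apply _

omit [HasPullbacks C] in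
/-- Through `e`, `Q` carries the diagonal-of-the-structure-map arrow to the arrow built from `f = theHom`.
[cite: MochizukiGeoAn2004, Prop. 1.2.5(ii) p.19] -/
theorem map_rightArrow (B₀ : C) :
    Q.map (rightArrow T B₀ (𝟙 T)) ≫ e.hom.app T = e.hom.app B₀ ≫ rightArrow S B₀ (theHom Q e) := by
  have hterm : Q.map (Over.mkIdTerminal.from ((Over.star T).obj B₀)) =
      (e.hom.app B₀ ≫ Over.mkIdTerminal.from ((Over.star S).obj B₀) ≫ (idIso Q).hom :
        Q.obj ((Over.star T).obj B₀) ⟶ Q.obj (Over.mk (𝟙 T))) :=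
    (isTerminalQId Q).hom_ext _ _
  calc Q.map (rightArrow T B₀ (𝟙 T)) ≫ e.hom.app T
      = Q.map (Over.mkIdTerminal.from ((Over.star T).obj B₀)) ≫ Q.map (sec T (𝟙 T)) ≫ e.hom.app T := by
        rw [rightArrow, Functor.map_comp, Category.assoc]
    _ = (e.hom.app B₀ ≫ Over.mkIdTerminal.from ((Over.star S).obj B₀) ≫ (idIso Q).hom) ≫
          Q.map (sec T (𝟙 T)) ≫ e.hom.app T := by rw [hterm]; rfl
    _ = e.hom.app B₀ ≫ rightArrow S B₀ (theHom Q e) := by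
        rw [rightArrow, sec_theHom, gamma]; simp only [Category.assoc]

/-- The parallel pair `Q(i_T^*(B) ⇉ i_T^*(T))` is, through `e`, the pair `i_S^*(B) ⇉ i_S^*(T)` for `f = theHom`.
[cite: MochizukiGeoAn2004, Prop. 1.2.5(ii) p.19] -/
def pairIso (B : Over T) :
    parallelPair (leftArrow B) (rightArrow T B.left (𝟙 T)) ⋙ Q ≅
      parallelPair ((Over.star S).map B.hom) (rightArrow S B.left (theHom Q e)) :=
  parallelPair.ext (e.app B.left) (e.app T)
    (by
      simp only [Functor.comp_map, parallelPair_map_left, Iso.app_hom]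
      exact e.hom.naturality B.hom)
    (by
      simp only [Functor.comp_map, parallelPair_map_right, Iso.app_hom]
      exact map_rightArrow Q e B.left)

/-- The component isomorphism `Q(B) ≅ f^*(B)`: both are limits of the (isomorphic) parallel pairs.
[cite: MochizukiGeoAn2004, Prop. 1.2.5(ii) p.19] -/
def objIso (B : Over T) : Q.obj B ≅ (Over.pullback (theHom Q e)).obj B :=
  IsLimit.conePointsIsoOfNatIso (isLimitOfPreserves Q (isLimitForkT B)) (isLimitForkS (theHom Q e) B)
    (pairIso Q e B)

/-- Bookkeeping step of the proof (`objIso_hom_iotaP`). [cite: MochizukiGeoAn2004, Prop. 1.2.5(ii) p.19] -/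
@[reassoc] theorem objIso_hom_iotaP (B : Over T) :
    (objIso Q e B).hom ≫ iotaP (theHom Q e) B = Q.map (graphHom B) ≫ e.hom.app B.left :=
  IsLimit.conePointsIsoOfNatIso_hom_comp (isLimitOfPreserves Q (isLimitForkT B))
    (isLimitForkS (theHom Q e) B) (pairIso Q e B) WalkingParallelPair.zero

/-- **`Q ≅ f^*`** for `f = theHom Q e`. [cite: MochizukiGeoAn2004, Prop. 1.2.5(ii) p.19] -/
def isoPullback : Q ≅ Over.pullback (theHom Q e) :=
  NatIso.ofComponents (fun B => objIso Q e B) (by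
    intro B B' k
    rw [← cancel_mono (iotaP (theHom Q e) B'), Category.assoc, Category.assoc, objIso_hom_iotaP,
      iotaP_naturality, objIso_hom_iotaP_assoc, ← Functor.map_comp_assoc, graphHom_naturality,
      Functor.map_comp_assoc]
    congr 1
    exact e.hom.naturality k.left)

include e in
/-- **Existence ("fullness") in [GeoAn] Prop. 1.2.5 (ii), in any category with binary products and
pullbacks**: a finite-limit-preserving `Q : Over T ⥤ Over S` with `Over.star T ⋙ Q ≅ Over.star S` is a
base change `Over.pullback f`. [cite: MochizukiGeoAn2004, Prop. 1.2.5(ii) p.19] -/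
theorem exists_iso_pullback : ∃ f : S ⟶ T, Nonempty (Q ≅ Over.pullback f) :=
  ⟨theHom Q e, ⟨isoPullback Q e⟩⟩

end Pullback

end Prop125ii

/-- **[GeoAn] Prop. 1.2.5 (ii), existence clause — PROVED for every Galois category (slimness, finite
étaleness and colimit preservation are not needed for existence).** [cite: MochizukiGeoAn2004, Prop. 1.2.5(ii) p.19] -/
theorem proposition_1_2_5_ii_exists (X : Type u) [Category.{v} X] [GaloisCategory X] (S T : X)
    (Q : Over T ⥤ Over S) [PreservesFiniteLimits Q]
    (h : Nonempty (Over.star T ⋙ Q ≅ Over.star S)) : ∃ f : S ⟶ T, Nonempty (Q ≅ Over.pullback f) :=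
  Prop125ii.exists_iso_pullback Q h.some

/-! ### Uniqueness (slim `X`) and the named fact as typed — appended, second filing round -/

namespace Prop125ii

variable {X : Type u} [Category.{v} X] [GaloisCategory X]

/-- **Uniqueness ("faithfulness") in [GeoAn] Prop. 1.2.5 (ii)**: for a SLIM connected anabelioid `X`, two
morphisms `f g : S ⟶ T` with isomorphic base-change functors `f^* ≅ g^* : X_T ⥤ X_S` are equal. Proof: by
mates (`Over.map f ⊣ Over.pullback f`) the isomorphism gives `Over.map g ≅ Over.map f`; forgetting to `X`
yields an automorphism of the extension functor `Over.forget S`, trivial by abc-iut-L3-d6's `forget_rigid`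
(Prop. 1.2.5 (i)); so the isomorphism `(S, 𝟙 ≫ g) ≅ (S, 𝟙 ≫ f)` in `X_T` has underlying map `𝟙_S`, whence
`f = g`. [cite: MochizukiGeoAn2004, Prop. 1.2.5(ii) p.19] -/
theorem eq_of_iso_pullback (hX : IsSlim X) {S T : X} (f g : S ⟶ T)
    (θ : Over.pullback f ≅ Over.pullback g) : f = g := by
  -- mates: an isomorphism of the left adjoints
  let φ : Over.map g ≅ Over.map f :=
    (conjugateIsoEquiv (Over.mapPullbackAdj f) (Over.mapPullbackAdj g)).symm θ
  -- forgetting to `X`: an automorphism of `Over.forget S`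
  let ψ : Over.forget S ≅ Over.forget S :=
    NatIso.ofComponents (fun U => (Over.forget T).mapIso (φ.app U)) (fun {U V} k =>
      congrArg (fun t => Over.Hom.left t) (φ.hom.naturality k))
  have hψ := forget_rigid hX S ψ
  have h1 : (φ.hom.app (Over.mk (𝟙 S))).left = 𝟙 (Over.mk (𝟙 S)).left := by
    have := congrArg (fun (i : Over.forget S ≅ Over.forget S) => i.hom.app (Over.mk (𝟙 S))) hψ
    simpa [ψ] using this
  have h2 := Over.w (φ.hom.app (Over.mk (𝟙 S)))
  erw [h1, Category.id_comp] at h2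
  -- `h2 : ((Over.map f).obj (S = S)).hom = ((Over.map g).obj (S = S)).hom`, i.e. `𝟙 ≫ f = 𝟙 ≫ g`
  have h3 : 𝟙 S ≫ f = 𝟙 S ≫ g := h2
  simpa using h3

end Prop125ii

/-- **[GeoAn] Proposition 1.2.5 (ii) AS TYPED — PROVED** (`proposition_1_2_5_ii`): for a slim connected
anabelioid `X`, every finite étale exact `Q : X_T ⥤ X_S` commuting with the structure morphisms is
`≅ Over.pullback f` for a unique `f : S ⟶ T` (existence: `proposition_1_2_5_ii_exists`, for every Galois
category; uniqueness: `Prop125ii.eq_of_iso_pullback`, by slimness through abc-iut-L3-d6's `forget_rigid`).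
[cite: MochizukiGeoAn2004, Prop. 1.2.5(ii) p.19] -/
theorem proposition_1_2_5_ii_holds : proposition_1_2_5_ii.{v, u} := by
  intro X _ _ hX S T Q _ _ _ h
  obtain ⟨f, ⟨i⟩⟩ := proposition_1_2_5_ii_exists X S T Q h
  refine ⟨f, ⟨i⟩, fun g ⟨j⟩ => ?_⟩
  exact (Prop125ii.eq_of_iso_pullback hX f g (i.symm ≪≫ j)).symm

end Literature.AnabelianGeometry.Anabelioids
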